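-- PORT-REPAIR carch-1-g56 2026-08-21T20:32Z: layer 1, not yet emitted; same macro block (line 44) = same bounce class — the RUN-81 source's file-local tactic macro `cplx_ring` (6-line block) DELETED and its 3 use(s) on 3 line(s) INLINED with the per-site pruned tactic (carch-1 g54/g55 rendering, hub 0 warnings); nothing else changed: line 1, imports, docstrings, statements byte-identical to port/staging.
/-
Origin: expansion seat `prover-pub-hodgecm-mc-carch-1-g4-0`, handover #CA30 2026-08-20T07:57Z md5 701d7b67a462 (477 l., 43 decls; NEW additive leaf; imports #CA28 Model.ArchU21Characters (this kit) only; RUN 44; INSTALL after #CA28; cert certs/ax-ArchUnitaryDetChar-701d7b67a462.log: rc 0 / 19 s / 0 warnings / 43/43 trio) (`HOME/mc/pub-hodgecm-mc-carch-1/pkg44/HodgeCM/Model/ArchUnitaryDetChar.lean`, md5 701d7b67a462, 477 lines);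
landed by the second packager p2 gen 4 (p2-g4) in gate run 44 as `HodgeCM/Model/ArchUnitaryDetChar.lean` (verbatim).
-/
/-
Copyright (c) 2026. Released under Apache 2.0 license as described in the file LICENSE.
Cell pub-hodgecm, MODEL layer (construction prover mc-carch-1, gen 4), BINDER-OWNERS row 12 `C`, junction (C-Λ), item (G1):
abelian characters of the COMPACT unitary groups `U(2)`, `U(3)` factor through `det`.
-/
import Summits.HodgeConjecture.HodgeCM.Model.ArchU21Characters_2

/-!
# Every homomorphism from the compact unitary group `U(2)` / `U(3)` to an abelian group factors through `det`

* § 1 (`U(2) = Matrix.unitaryGroup (Fin 2) ℂ`, any `ψ : U(2) →* M`, `M` a commutative group): `diag(w, w̄)` is killed — with `v² = w`,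
  `diag(w,w̄) = diag(v,v̄)²` and `diag(v,v̄)`, `diag(v̄,v)` are conjugate under `J₂ = (0 1; −1 0)`; the real rotations are killed (conjugate by the
  fixed unitary `cayU` of #CA28 to `diag(z, z̄)`); hence **`map_eq_one_of_det_eq_one`** (ψ kills `SU(2)`, by the square-root-free factorisation
  `s = diag(α,ᾱ)·diag(1,ω)·R(‖a‖,‖b‖)·diag(1,ω̄)` of #CA28 § 5) and **`map_eq_map_diagInl : ψ A = ψ (diag(det A, 1))`**;
* § 2 (`U(3)`): the block embeddings `inl01`, `inr12 : U(2) →* U(3)`, `D3 : U(1) →* U(3)` (`z ↦ diag(z,1,1)`), the Givens factorisation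
  **`exists_inl01_mul_inr12_mul_eq_inr12`** (`k₂ k₁ u = 1 ⊕ B`: two rotations clear the first column), hence **`map_eq_map_D3 : χ u = χ (D3 (det u))`**
  and, with continuity along the circle, **`exists_zpow_of_continuous3 : ∃ m : ℤ, ∀ u, χ u = det(u)^m`** (twin `CircleChar.existsUnique_zpow_complex`,
  [BröckerTomDieck1985, II (8.1)]);
* (sibling leaf `Model/ArchUnitaryFormDetChar`: the transport to `U(H) = unitaryGroupOfForm conj (diagonal h)`, `h` real of one sign — the
  archimedean local groups `archLocal … (cmPlaceOver b)` of a DEFINITE place — and `exists_zpow_of_continuous_form`.)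

Kernel only: 0 records, 0 `def … : Prop`, nothing cited as a hypothesis.  Used by the C lane for (Λ-def) of (C-Λ): the see-saw discrepancy
`cmLineChar₀((archSingle_b u)^𝔸, 1)` is `det(u)^{ℓ_b}` on `U(V)(L_b)` at every definite `b`, so (c5)₀ becomes a read-off on the type of `η₀` at `w(b)`.
-/

set_option autoImplicit false

noncomputable section

open scoped Matrix
open ComplexConjugate Complex

namespace HodgeCM.Model.U3Char

open HodgeCM.Model.U21Char (diag2U coe_diag2U rotU coe_rotU cayU coe_cayU rotU_mul_cayU unitOf coe_unitOf detU coe_detU diagInl coe_diagInl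
  conj_mul_self_of_unitary conj_det_mul_self circleToUnitary coe_circleToUnitary unitaryToCircle circleToUnitary_unitaryToCircle norm_coe_unitary)

/-- (Ported verbatim from the HodgeCMPerL package; no docstring in the source.) -/
theorem U2_eq_of_coe_eq {A B : Matrix.unitaryGroup (Fin 2) ℂ} (h : (A : Matrix (Fin 2) (Fin 2) ℂ) = B) : A = B := Subtype.ext h

/-! ## § 1 `U(2)`: every abelian character kills `SU(2)` -/

/-- `J₂ = (0 1; −1 0) ∈ U(2)`. -/
def J2 : Matrix.unitaryGroup (Fin 2) ℂ :=
  ⟨!![0, 1; -1, 0], by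
    rw [Matrix.mem_unitaryGroup_iff']
    ext i j; fin_cases i <;> fin_cases j <;> simp [Matrix.mul_apply, Fin.sum_univ_two, Matrix.star_apply]⟩

/-- (Ported verbatim from the HodgeCMPerL package; no docstring in the source.) -/
@[simp] theorem coe_J2 : (J2 : Matrix (Fin 2) (Fin 2) ℂ) = !![0, 1; -1, 0] := rfl

/-- `J₂ · diag(a, b) = diag(b, a) · J₂`. -/
theorem J2_mul_diag2U (a b : ℂ) (ha : conj a * a = 1) (hb : conj b * b = 1) :
    J2 * diag2U a b ha hb = diag2U b a hb ha * J2 :=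
  U2_eq_of_coe_eq (by
    change (J2 : Matrix (Fin 2) (Fin 2) ℂ) * (diag2U a b ha hb : Matrix (Fin 2) (Fin 2) ℂ) = (diag2U b a hb ha : Matrix _ _ ℂ) * (J2 : Matrix _ _ ℂ)
    rw [coe_J2, coe_diag2U, coe_diag2U]
    ext i j; fin_cases i <;> fin_cases j <;> simp [Matrix.mul_apply, Fin.sum_univ_two])

/-- (Ported verbatim from the HodgeCMPerL package; no docstring in the source.) -/
theorem diag2U_mul_diag2U (a b c d : ℂ) (ha : conj a * a = 1) (hb : conj b * b = 1) (hc : conj c * c = 1) (hd : conj d * d = 1) :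
    diag2U a b ha hb * diag2U c d hc hd =
      diag2U (a * c) (b * d) (by rw [map_mul, mul_mul_mul_comm, ha, hc, mul_one]) (by rw [map_mul, mul_mul_mul_comm, hb, hd, mul_one]) :=
  U2_eq_of_coe_eq (by
    change (diag2U a b ha hb : Matrix (Fin 2) (Fin 2) ℂ) * (diag2U c d hc hd : Matrix (Fin 2) (Fin 2) ℂ) = (diag2U _ _ _ _ : Matrix _ _ ℂ)
    rw [coe_diag2U, coe_diag2U, coe_diag2U]
    ext i j; fin_cases i <;> fin_cases j <;> simp [Matrix.mul_apply, Fin.sum_univ_two])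

/-- (Ported verbatim from the HodgeCMPerL package; no docstring in the source.) -/
theorem diag2U_one_one (h : conj (1 : ℂ) * 1 = 1) : diag2U 1 1 h h = 1 :=
  U2_eq_of_coe_eq (by
    change (diag2U 1 1 h h : Matrix (Fin 2) (Fin 2) ℂ) = 1
    rw [coe_diag2U]; ext i j; fin_cases i <;> fin_cases j <;> simp)

section U2

variable {M : Type*} [CommGroup M] (ψ : Matrix.unitaryGroup (Fin 2) ℂ →* M)

/-- `ψ (diag(a, b)) = ψ (diag(b, a))`. -/
theorem map_diag2U_swap (a b : ℂ) (ha : conj a * a = 1) (hb : conj b * b = 1) : ψ (diag2U a b ha hb) = ψ (diag2U b a hb ha) := by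
  have h := congrArg ψ (J2_mul_diag2U a b ha hb)
  rw [map_mul, map_mul, mul_comm (ψ (diag2U b a hb ha))] at h
  exact mul_left_cancel h

/-- **`ψ (diag(w, w̄)) = 1`**: with `v² = w`, `diag(w,w̄) = diag(v,v̄)·diag(v,v̄)` and `ψ(diag(v,v̄)) = ψ(diag(v̄,v))` is its own inverse. -/
theorem map_diag2U_conj (w : ℂ) (hw : conj w * w = 1) (hw' : conj (conj w) * conj w = 1) : ψ (diag2U w (conj w) hw hw') = 1 := by
  obtain ⟨v, hv⟩ := IsAlgClosed.exists_pow_nat_eq w (n := 2) two_pos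
  have hvv : conj v * v = 1 := by
    have h1 : (conj v * v) ^ 2 = 1 := by rw [mul_pow, ← map_pow, hv, hw]
    have hnn : conj v * v = ((‖v‖ ^ 2 : ℝ) : ℂ) := by rw [Complex.conj_mul', Complex.ofReal_pow]
    rw [hnn] at h1 ⊢
    have h2 : (‖v‖ ^ 2) ^ 2 = (1 : ℝ) := by exact_mod_cast h1
    have h3 : ‖v‖ ^ 2 = 1 := by nlinarith [sq_nonneg ‖v‖, sq_nonneg (‖v‖ ^ 2 - 1)]
    rw [h3, Complex.ofReal_one]
  have hvv' : conj (conj v) * conj v = 1 := by rw [conj_conj, mul_comm, hvv]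
  have e : diag2U w (conj w) hw hw' = diag2U v (conj v) hvv hvv' * diag2U v (conj v) hvv hvv' := by
    rw [diag2U_mul_diag2U]
    exact U2_eq_of_coe_eq (by rw [coe_diag2U, coe_diag2U, ← hv, map_pow, pow_two, pow_two])
  have e2 : diag2U v (conj v) hvv hvv' * diag2U (conj v) v hvv' hvv = 1 := by
    rw [diag2U_mul_diag2U, ← diag2U_one_one (by rw [map_one, mul_one])]
    exact U2_eq_of_coe_eq (by rw [coe_diag2U, coe_diag2U, mul_comm v, hvv])
  rw [e, map_mul]
  nth_rewrite 2 [map_diag2U_swap]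
  rw [← map_mul, e2, map_one]

/-- `ψ (diag(p, q)) = 1` when `p q = 1`. -/
theorem map_diag2U_eq_one (p q : ℂ) (hp : conj p * p = 1) (hq : conj q * q = 1) (hpq : p * q = 1) : ψ (diag2U p q hp hq) = 1 := by
  have hq' : q = conj p := by
    have : conj p * (p * q) = conj p := by rw [hpq, mul_one]
    rw [← mul_assoc, hp, one_mul] at this
    exact this
  subst hq'
  exact map_diag2U_conj ψ p hp hq

/-- `ψ` kills the real rotations. -/
theorem map_rotU_eq_one (x y : ℝ) (h : x ^ 2 + y ^ 2 = 1) : ψ (rotU x y h) = 1 := by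
  have hC : (x : ℂ) ^ 2 + (y : ℂ) ^ 2 = 1 := by exact_mod_cast h
  have hz : conj ((x : ℂ) + y * I) * ((x : ℂ) + y * I) = 1 := by
    linear_combination (norm := skip) hC
    ((try simp only [map_add, map_mul, Complex.conj_I, Complex.conj_ofReal]); first | ring1 | (ring_nf; simp only [Complex.I_sq]; ring1))
  have hz' : conj ((x : ℂ) - y * I) * ((x : ℂ) - y * I) = 1 := by
    linear_combination (norm := skip) hC
    ((try simp only [map_sub, map_mul, Complex.conj_I, Complex.conj_ofReal]); first | ring1 | (ring_nf; simp only [Complex.I_sq]; ring1))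
  have hzz : ((x : ℂ) + y * I) * ((x : ℂ) - y * I) = 1 := by
    linear_combination (norm := skip) hC
    (first | ring1 | (ring_nf; simp only [Complex.I_sq]; ring1))
  have e := congrArg ψ (rotU_mul_cayU x y h hz hz')
  rw [map_mul, map_mul, map_diag2U_eq_one ψ _ _ hz hz' hzz, mul_one, mul_comm] at e
  exact mul_left_cancel (e.trans (mul_one _).symm)

/-- **`ψ` kills `SU(2)`.** -/
theorem map_eq_one_of_det_eq_one (A : Matrix.unitaryGroup (Fin 2) ℂ) (hA : (A : Matrix (Fin 2) (Fin 2) ℂ).det = 1) : ψ A = 1 := by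
  have hsu : (A : Matrix (Fin 2) (Fin 2) ℂ) ∈ Matrix.specialUnitaryGroup (Fin 2) ℂ :=
    Matrix.mem_specialUnitaryGroup_iff.mpr ⟨A.2, hA⟩
  obtain ⟨r00, r10, -, -, hd⟩ := Literature.Geometry.ComplexHyperbolic.BallModel.su2_rel hsu
  obtain ⟨a, b, h00, h10⟩ : ∃ a b : ℂ, (A : Matrix (Fin 2) (Fin 2) ℂ) 0 0 = a ∧ (A : Matrix (Fin 2) (Fin 2) ℂ) 1 0 = b :=
    ⟨_, _, rfl, rfl⟩
  rw [h00] at r00 hd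
  rw [h10] at r10 hd
  have h01 : (A : Matrix (Fin 2) (Fin 2) ℂ) 0 1 = -conj b := by rw [r10, neg_neg]
  have h11 : (A : Matrix (Fin 2) (Fin 2) ℂ) 1 1 = conj a := r00.symm
  have hn : conj a * a + conj b * b = 1 := by rw [h01, h11] at hd; linear_combination hd
  have hA_eq : ∀ B : Matrix.unitaryGroup (Fin 2) ℂ, (B : Matrix (Fin 2) (Fin 2) ℂ) = !![a, -conj b; b, conj a] → A = B :=
    fun B hB => Subtype.ext (by
      rw [hB]; ext i j; fin_cases i <;> fin_cases j
      · exact h00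
      · exact h01
      · exact h10
      · exact h11)
  by_cases ha : a = 0
  · have hb : conj b * b = 1 := by rw [ha, map_zero, zero_mul, zero_add] at hn; exact hn
    have hb' : conj (conj b) * conj b = 1 := by rw [conj_conj, mul_comm, hb]
    have e : A = rotU 0 1 (by norm_num) * diag2U b (conj b) hb hb' := hA_eq _ (by
      change (rotU 0 1 _ : Matrix (Fin 2) (Fin 2) ℂ) * (diag2U b (conj b) hb hb' : Matrix (Fin 2) (Fin 2) ℂ) = _
      rw [coe_rotU, coe_diag2U, ha]
      ext i j; fin_cases i <;> fin_cases j <;> simp [Matrix.mul_apply, Fin.sum_univ_two])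
    rw [e, map_mul, map_rotU_eq_one, map_diag2U_eq_one ψ _ _ hb hb' (by rw [mul_comm, hb]), mul_one]
  · have hna : (‖a‖ : ℂ) ≠ 0 := by exact_mod_cast (norm_ne_zero_iff.mpr ha)
    have haa : conj a * a = (‖a‖ : ℂ) ^ 2 := Complex.conj_mul' a
    obtain ⟨α, hαa, hα⟩ : ∃ α : ℂ, α * ‖a‖ = a ∧ conj α * α = 1 :=
      ⟨a / ‖a‖, div_mul_cancel₀ a hna, by
        rw [map_div₀, Complex.conj_ofReal, div_mul_div_comm, haa, ← pow_two, div_self (pow_ne_zero 2 hna)]⟩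
    obtain ⟨β, hβb, hβ⟩ : ∃ β : ℂ, β * ‖b‖ = b ∧ conj β * β = 1 := by
      by_cases hb : b = 0
      · exact ⟨1, by rw [hb, norm_zero, Complex.ofReal_zero, mul_zero], by rw [map_one, mul_one]⟩
      · have hnb : (‖b‖ : ℂ) ≠ 0 := by exact_mod_cast (norm_ne_zero_iff.mpr hb)
        have hbb : conj b * b = (‖b‖ : ℂ) ^ 2 := Complex.conj_mul' b
        exact ⟨b / ‖b‖, div_mul_cancel₀ b hnb, by
          rw [map_div₀, Complex.conj_ofReal, div_mul_div_comm, hbb, ← pow_two, div_self (pow_ne_zero 2 hnb)]⟩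
    obtain ⟨ω, hω_def⟩ : ∃ ω : ℂ, ω = α * β := ⟨_, rfl⟩
    have hα' : conj (conj α) * conj α = 1 := by rw [conj_conj, mul_comm, hα]
    have hα2 : α * conj α = 1 := by rw [mul_comm, hα]
    have hω : conj ω * ω = 1 := by rw [hω_def, map_mul, mul_mul_mul_comm, hα, hβ, mul_one]
    have hω' : conj (conj ω) * conj ω = 1 := by rw [conj_conj, mul_comm, hω]
    have hω2 : ω * conj ω = 1 := by rw [mul_comm, hω]
    have hcω : conj ω = conj α * conj β := by rw [hω_def, map_mul]
    have hαa' : conj α * ‖a‖ = conj a := by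
      have h := congrArg conj hαa; rwa [map_mul, Complex.conj_ofReal] at h
    have hβb' : conj β * ‖b‖ = conj b := by
      have h := congrArg conj hβb; rwa [map_mul, Complex.conj_ofReal] at h
    have h1 : conj (1 : ℂ) * 1 = 1 := by rw [map_one, mul_one]
    have hxy : ‖a‖ ^ 2 + ‖b‖ ^ 2 = 1 := by
      have : ((‖a‖ ^ 2 + ‖b‖ ^ 2 : ℝ) : ℂ) = 1 := by
        push_cast
        rw [← haa, ← Complex.conj_mul', hn]
      exact_mod_cast this
    have e : A = diag2U α (conj α) hα hα' * diag2U 1 ω h1 hω * rotU ‖a‖ ‖b‖ hxy * diag2U 1 (conj ω) h1 hω' :=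
      hA_eq _ (by
        change (diag2U α (conj α) hα hα' : Matrix (Fin 2) (Fin 2) ℂ) * (diag2U 1 ω h1 hω : Matrix (Fin 2) (Fin 2) ℂ) *
            (rotU ‖a‖ ‖b‖ hxy : Matrix (Fin 2) (Fin 2) ℂ) * (diag2U 1 (conj ω) h1 hω' : Matrix (Fin 2) (Fin 2) ℂ) = _
        rw [coe_diag2U, coe_diag2U, coe_rotU, coe_diag2U]
        ext i j
        fin_cases i <;> fin_cases j <;> simp [Matrix.mul_apply, Fin.sum_univ_two]
        · linear_combination hαa
        · linear_combination (α * (‖b‖ : ℂ)) * hcω + ((‖b‖ : ℂ) * conj β) * hα2 + hβb'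
        · linear_combination (conj α * (‖b‖ : ℂ)) * hω_def + (β * (‖b‖ : ℂ)) * hα + hβb
        · linear_combination (conj α * (‖a‖ : ℂ)) * hω2 + hαa')
    have hcancel : diag2U 1 ω h1 hω * diag2U 1 (conj ω) h1 hω' = 1 := by
      rw [diag2U_mul_diag2U, ← diag2U_one_one h1]
      exact U2_eq_of_coe_eq (by rw [coe_diag2U, coe_diag2U, one_mul, hω2])
    rw [e, map_mul, map_mul, map_mul, map_rotU_eq_one, mul_one, map_diag2U_eq_one ψ _ _ hα hα' hα2, one_mul, ← map_mul, hcancel, map_one]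

/-- **on `U(2)` every abelian character is a function of `det`: `ψ A = ψ (diag(det A, 1))`.** -/
theorem map_eq_map_diagInl (A : Matrix.unitaryGroup (Fin 2) ℂ) : ψ A = ψ (diagInl (detU A)) := by
  have hc : conj (conj ((detU A : unitary ℂ) : ℂ)) * conj ((detU A : unitary ℂ) : ℂ) = 1 := by
    rw [conj_conj, mul_comm]; exact conj_mul_self_of_unitary _
  have hww' : detU A * unitOf _ hc = 1 := Subtype.ext (by
    change ((detU A : unitary ℂ) : ℂ) * conj ((detU A : unitary ℂ) : ℂ) = 1
    rw [mul_comm]; exact conj_mul_self_of_unitary _)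
  have hdet : ((diagInl (unitOf _ hc) * A : Matrix.unitaryGroup (Fin 2) ℂ) : Matrix (Fin 2) (Fin 2) ℂ).det = 1 := by
    change ((diagInl (unitOf _ hc) : Matrix (Fin 2) (Fin 2) ℂ) * (A : Matrix (Fin 2) (Fin 2) ℂ)).det = 1
    rw [Matrix.det_mul, coe_diagInl, Matrix.det_fin_two_of, coe_unitOf, coe_detU, mul_one, mul_zero, sub_zero]
    exact conj_det_mul_self A
  have e : A = diagInl (detU A) * (diagInl (unitOf _ hc) * A) := by
    rw [← mul_assoc, ← map_mul, hww', map_one, one_mul]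
  calc ψ A = ψ (diagInl (detU A) * (diagInl (unitOf _ hc) * A)) := by rw [← e]
    _ = ψ (diagInl (detU A)) := by rw [map_mul, map_eq_one_of_det_eq_one ψ _ hdet, mul_one]

end U2

/-! ## § 2 `U(3)`: block embeddings, Givens factorisation, `χ u = χ (diag(det u, 1, 1))` -/

/-- (Ported verbatim from the HodgeCMPerL package; no docstring in the source.) -/
theorem U3_eq_of_coe_eq {A B : Matrix.unitaryGroup (Fin 3) ℂ} (h : (A : Matrix (Fin 3) (Fin 3) ℂ) = B) : A = B := Subtype.ext h

/-- the matrix `A ⊕ 1`. -/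
def inl01Mat (A : Matrix (Fin 2) (Fin 2) ℂ) : Matrix (Fin 3) (Fin 3) ℂ := !![A 0 0, A 0 1, 0; A 1 0, A 1 1, 0; 0, 0, 1]

/-- the matrix `1 ⊕ A`. -/
def inr12Mat (A : Matrix (Fin 2) (Fin 2) ℂ) : Matrix (Fin 3) (Fin 3) ℂ := !![1, 0, 0; 0, A 0 0, A 0 1; 0, A 1 0, A 1 1]

/-- (Ported verbatim from the HodgeCMPerL package; no docstring in the source.) -/
theorem inl01Mat_mul (A B : Matrix (Fin 2) (Fin 2) ℂ) : inl01Mat A * inl01Mat B = inl01Mat (A * B) := by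
  ext i j; fin_cases i <;> fin_cases j <;> simp [inl01Mat, Matrix.mul_apply, Fin.sum_univ_three, Fin.sum_univ_two]

/-- (Ported verbatim from the HodgeCMPerL package; no docstring in the source.) -/
theorem inr12Mat_mul (A B : Matrix (Fin 2) (Fin 2) ℂ) : inr12Mat A * inr12Mat B = inr12Mat (A * B) := by
  ext i j; fin_cases i <;> fin_cases j <;> simp [inr12Mat, Matrix.mul_apply, Fin.sum_univ_three, Fin.sum_univ_two]

/-- (Ported verbatim from the HodgeCMPerL package; no docstring in the source.) -/
theorem inl01Mat_one : inl01Mat 1 = 1 := by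
  ext i j; fin_cases i <;> fin_cases j <;> simp [inl01Mat]

/-- (Ported verbatim from the HodgeCMPerL package; no docstring in the source.) -/
theorem inr12Mat_one : inr12Mat 1 = 1 := by
  ext i j; fin_cases i <;> fin_cases j <;> simp [inr12Mat]

/-- (Ported verbatim from the HodgeCMPerL package; no docstring in the source.) -/
theorem star_inl01Mat (A : Matrix (Fin 2) (Fin 2) ℂ) : star (inl01Mat A) = inl01Mat (star A) := by
  ext i j; fin_cases i <;> fin_cases j <;> simp [inl01Mat, Matrix.star_apply]

/-- (Ported verbatim from the HodgeCMPerL package; no docstring in the source.) -/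
theorem star_inr12Mat (A : Matrix (Fin 2) (Fin 2) ℂ) : star (inr12Mat A) = inr12Mat (star A) := by
  ext i j; fin_cases i <;> fin_cases j <;> simp [inr12Mat, Matrix.star_apply]

/-- `A ↦ A ⊕ 1 : U(2) →* U(3)`. -/
def inl01 : Matrix.unitaryGroup (Fin 2) ℂ →* Matrix.unitaryGroup (Fin 3) ℂ where
  toFun A := ⟨inl01Mat A, by
    rw [Matrix.mem_unitaryGroup_iff', star_inl01Mat, inl01Mat_mul, Matrix.mem_unitaryGroup_iff'.mp A.2, inl01Mat_one]⟩
  map_one' := Subtype.ext (by change inl01Mat 1 = 1; exact inl01Mat_one)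
  map_mul' A B := Subtype.ext (by change inl01Mat (A * B) = inl01Mat A * inl01Mat B; rw [inl01Mat_mul])

/-- `A ↦ 1 ⊕ A : U(2) →* U(3)`. -/
def inr12 : Matrix.unitaryGroup (Fin 2) ℂ →* Matrix.unitaryGroup (Fin 3) ℂ where
  toFun A := ⟨inr12Mat A, by
    rw [Matrix.mem_unitaryGroup_iff', star_inr12Mat, inr12Mat_mul, Matrix.mem_unitaryGroup_iff'.mp A.2, inr12Mat_one]⟩
  map_one' := Subtype.ext (by change inr12Mat 1 = 1; exact inr12Mat_one)
  map_mul' A B := Subtype.ext (by change inr12Mat (A * B) = inr12Mat A * inr12Mat B; rw [inr12Mat_mul])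

/-- (Ported verbatim from the HodgeCMPerL package; no docstring in the source.) -/
@[simp] theorem coe_inl01 (A : Matrix.unitaryGroup (Fin 2) ℂ) : (inl01 A : Matrix (Fin 3) (Fin 3) ℂ) = inl01Mat A := rfl
/-- (Ported verbatim from the HodgeCMPerL package; no docstring in the source.) -/
@[simp] theorem coe_inr12 (A : Matrix.unitaryGroup (Fin 2) ℂ) : (inr12 A : Matrix (Fin 3) (Fin 3) ℂ) = inr12Mat A := rfl

/-- **`D3 : U(1) →* U(3)`, `z ↦ diag(z, 1, 1)`.** -/
def D3 : unitary ℂ →* Matrix.unitaryGroup (Fin 3) ℂ := inl01.comp diagInl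

/-- (Ported verbatim from the HodgeCMPerL package; no docstring in the source.) -/
theorem coe_D3 (w : unitary ℂ) : (D3 w : Matrix (Fin 3) (Fin 3) ℂ) = !![(w : ℂ), 0, 0; 0, 1, 0; 0, 0, 1] := by
  change inl01Mat (diagInl w : Matrix (Fin 2) (Fin 2) ℂ) = _
  rw [coe_diagInl]
  ext i j; fin_cases i <;> fin_cases j <;> simp [inl01Mat]

/-- (Ported verbatim from the HodgeCMPerL package; no docstring in the source.) -/
theorem conj_det_mul_self3 (u : Matrix.unitaryGroup (Fin 3) ℂ) :
    conj (u : Matrix (Fin 3) (Fin 3) ℂ).det * (u : Matrix (Fin 3) (Fin 3) ℂ).det = 1 := by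
  have h := congrArg Matrix.det (Matrix.mem_unitaryGroup_iff'.mp u.2)
  rwa [Matrix.det_mul, Matrix.det_one, Matrix.star_eq_conjTranspose, Matrix.det_conjTranspose] at h

/-- `det : U(3) →* U(1)`. -/
def det3U : Matrix.unitaryGroup (Fin 3) ℂ →* unitary ℂ where
  toFun u := unitOf (u : Matrix (Fin 3) (Fin 3) ℂ).det (conj_det_mul_self3 u)
  map_one' := Subtype.ext (by simp)
  map_mul' A B := Subtype.ext (by simp [Matrix.det_mul])

/-- (Ported verbatim from the HodgeCMPerL package; no docstring in the source.) -/
@[simp] theorem coe_det3U (u : Matrix.unitaryGroup (Fin 3) ℂ) : (det3U u : ℂ) = (u : Matrix (Fin 3) (Fin 3) ℂ).det := rfl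

/-- (Ported verbatim from the HodgeCMPerL package; no docstring in the source.) -/
theorem det_inl01Mat (A : Matrix (Fin 2) (Fin 2) ℂ) : (inl01Mat A).det = A.det := by
  rw [Matrix.det_fin_three, Matrix.det_fin_two]; simp [inl01Mat]

/-- (Ported verbatim from the HodgeCMPerL package; no docstring in the source.) -/
theorem det_inr12Mat (A : Matrix (Fin 2) (Fin 2) ℂ) : (inr12Mat A).det = A.det := by
  rw [Matrix.det_fin_three, Matrix.det_fin_two]; simp [inr12Mat]

/-- (Ported verbatim from the HodgeCMPerL package; no docstring in the source.) -/
theorem det3U_inl01 (A : Matrix.unitaryGroup (Fin 2) ℂ) : det3U (inl01 A) = detU A :=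
  Subtype.ext (by rw [coe_det3U, coe_detU, coe_inl01, det_inl01Mat])

/-- (Ported verbatim from the HodgeCMPerL package; no docstring in the source.) -/
theorem det3U_inr12 (A : Matrix.unitaryGroup (Fin 2) ℂ) : det3U (inr12 A) = detU A :=
  Subtype.ext (by rw [coe_det3U, coe_detU, coe_inr12, det_inr12Mat])

open Literature.Geometry.ComplexHyperbolic.BallModel (su2Mat su2Mat_mem)

/-- an `SU(2)` matrix as an element of `U(2)`. -/
def su2U (a b : ℂ) (h : conj a * a + conj b * b = 1) : Matrix.unitaryGroup (Fin 2) ℂ :=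
  ⟨su2Mat a b, (Matrix.mem_specialUnitaryGroup_iff.mp (su2Mat_mem a b h)).1⟩

/-- (Ported verbatim from the HodgeCMPerL package; no docstring in the source.) -/
@[simp] theorem coe_su2U (a b : ℂ) (h : conj a * a + conj b * b = 1) : (su2U a b h : Matrix (Fin 2) (Fin 2) ℂ) = su2Mat a b := rfl

/-- a unitary `3 × 3` matrix whose first column is `e₀` is `1 ⊕ B`. -/
theorem exists_eq_inr12 (w : Matrix.unitaryGroup (Fin 3) ℂ) (h00 : (w : Matrix (Fin 3) (Fin 3) ℂ) 0 0 = 1)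
    (h10 : (w : Matrix (Fin 3) (Fin 3) ℂ) 1 0 = 0) (h20 : (w : Matrix (Fin 3) (Fin 3) ℂ) 2 0 = 0) :
    ∃ B : Matrix.unitaryGroup (Fin 2) ℂ, w = inr12 B := by
  have hw : star (w : Matrix (Fin 3) (Fin 3) ℂ) * w = 1 := Matrix.mem_unitaryGroup_iff'.mp w.2
  have hent : ∀ i j : Fin 3, (star (w : Matrix (Fin 3) (Fin 3) ℂ) * w) i j = (1 : Matrix (Fin 3) (Fin 3) ℂ) i j :=
    fun i j => by rw [hw]
  have h01 : (w : Matrix (Fin 3) (Fin 3) ℂ) 0 1 = 0 := by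
    have h := hent 0 1
    simp [Matrix.mul_apply, Fin.sum_univ_three, Matrix.star_apply, h00, h10, h20] at h
    exact h
  have h02 : (w : Matrix (Fin 3) (Fin 3) ℂ) 0 2 = 0 := by
    have h := hent 0 2
    simp [Matrix.mul_apply, Fin.sum_univ_three, Matrix.star_apply, h00, h10, h20] at h
    exact h
  let B : Matrix (Fin 2) (Fin 2) ℂ := !![(w : Matrix (Fin 3) (Fin 3) ℂ) 1 1, (w : Matrix (Fin 3) (Fin 3) ℂ) 1 2;
    (w : Matrix (Fin 3) (Fin 3) ℂ) 2 1, (w : Matrix (Fin 3) (Fin 3) ℂ) 2 2]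
  have hB : B ∈ Matrix.unitaryGroup (Fin 2) ℂ := by
    rw [Matrix.mem_unitaryGroup_iff']
    have h11 := hent 1 1
    have h12 := hent 1 2
    have h21 := hent 2 1
    have h22 := hent 2 2
    simp [Matrix.mul_apply, Fin.sum_univ_three, Matrix.star_apply, h01, h02] at h11 h12 h21 h22
    ext i j
    fin_cases i <;> fin_cases j <;> simp [B, Matrix.mul_apply, Fin.sum_univ_two, Matrix.star_apply]
    · exact h11
    · exact h12
    · exact h21
    · exact h22
  refine ⟨⟨B, hB⟩, U3_eq_of_coe_eq ?_⟩
  rw [coe_inr12]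
  ext i j
  fin_cases i <;> fin_cases j <;> simp [inr12Mat, B, h00, h01, h02, h10, h20]


-- port_pkg: scope closed for this part
end HodgeCM.Model.U3Char
end
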